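import Summits.HodgeConjecture.CorCM.Census.HalfParity
import Summits.HodgeConjecture.CorCM.Census.CoinvariantCyclic

/-!
# The half-parity law, III: the invariant `t(G, c)` and THE FLOOR `β − 1 − δ + t ≤ φ₂ ≤ |S|`

COR-CM (cell `pub-hodgecm2`), count-neutral kernel combinatorics by the binder seat b09 (gen 30; lane HALF-PARITY-LAW,
André-3's ask A6-R52), part III, sequel of `Census/HalfParity.lean` (the half-parities `hsum A` of half-block sets `A` of
index-two subgroups `H ∋ c` kill `rad2` when `sat A` carries a parity relation).  Three bookkeeping definitions (`admHalves`,
`hpi`, `halfRank`) + theorems; no `Prop`-valued definition, no `decide`, no certificate, no named fact, no `sorry`.  HONEST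
FRAMING: `HC_CM` is NOT proved; nothing here is a period or a headline.

CONTENT.
* §1 **Linear algebra**: rank–nullity on a subspace (`finrank_map_add_finrank_inf_ker`) and the PRODUCT FORMULA
  `dim (p, q)(W) = dim p(W) + dim q(W ∩ ker p)` (`finrank_map_prod_eq`).
* §2 **The generic floor** (`finrank_map_hodge2_le_fibreTwo`): ANY linear map `L` on `𝔽₂[types]` killing `rad2` has
  `dim L(hodge2) ≤ φ₂(G, c)`; with `L = (par2, L')`: **`β − 1 − δ + dim L'(hodge2 ∩ ker par2) ≤ φ₂`**
  (`card_block_add_finrank_le_fibreTwo_add`; `dim par2(hodge2) = β − 1 − δ` is gen 28's exact rank via gen 29's `map_par2_hodge2`).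
* §3 **The invariant `t(G, c)`** (`halfRank`): `admHalves` = ALL admissible half-block sets `A` (for some index-two `H ∋ c`:
  `H`-stable, disjoint from `A·Q⁻¹` for `Q ∉ H`, `hsum (sat A)` a relation on the faces), `hpi` = the joint evaluation
  `x ↦ (hsum A x)_A`, and **`t(G, c) := dim_𝔽₂ hpi(hodge2 ∩ ker par2)`** = the number of half-parity classes independent of the
  block parities on the Hodge lattice mod `2` (André-3's «NEW», choice-free).  `rad2 ≤ ker hpi` (part I MAIN for every member).
* §4 **THE FLOOR** (`card_block_add_halfRank_le_fibreTwo_add`): **`β(G, c) + t(G, c) ≤ φ₂(G, c) + 1 + δ(G, c)`** for every finite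
  group `G` and involution `c` — and hence (gen 29 `fibreTwo_le_card`) **`|S| ≥ β − 1 − δ + t`** for every family `S` of integer
  Hodge vectors whose base changes generate the faces modulo pairs (`card_block_add_halfRank_le_card_add`).  André-3's LAW
  (PORTFOLIO-g17 §3, all 58 Galois CM types of order `≤ 24`) is the EQUALITY `φ₂ = β − 1 − δ + t`; only `≥` is claimed here.
* §5 **Witness criteria** for `t ≥ k` without computing `admHalves`: admissible `A₁ … A_k` and Hodge vectors `x₁ … x_k` mod `2`
  with vanishing block parities and `hsum Aᵢ xⱼ = δᵢⱼ` give `k ≤ t` (`le_halfRank_of_dual_family`; `k = 1`: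
  `one_le_halfRank_of_witness`) — the shape of André-3's certificates (`Q₈`, `Q₁₆`, `Dic₆`, `ℤ/3×Q₈`: `t ≥ 2`; `SD₁₆`, `M₁₆`,
  `ℤ/4×S₃`, …: `t ≥ 1`).
* §6 **Vanishing**: when `φ₂` already equals the parity rank (`fibreTwo = dim span par(faces)`: gen 29's cyclic, odd-half-order
  and split-cyclic theorems) every admissible half-parity is a parity combination on the Hodge lattice: **`t = 0`**
  (`halfRank_eq_zero_of_fibreTwo_eq`).

## References
* [Pohlmann1968] H. Pohlmann, Algebraic cycles on abelian varieties of complex multiplication type, Ann. of Math. 88 (1968), Thm 1.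
* [Milne1999] J. S. Milne, Lefschetz motives and the Tate conjecture, Compositio Math. 117 (1999), Prop. 2.1, p. 54.
-/

namespace Summit.HodgeConjecture.CorCM.Census.HalfParity

open Finset
open Summit.HodgeConjecture.CorCM.Prior.AllgGroup.RfwfAllgGroup
open Summit.HodgeConjecture.CorCM.Census.BlockParity
open Summit.HodgeConjecture.CorCM.Census.Coinvariant

noncomputable section

/-! ## §1 Linear algebra: rank–nullity on a subspace and the product formula -/

section LinAlg

variable {K : Type*} [DivisionRing K] {V V₁ V₂ : Type*} [AddCommGroup V] [Module K V] [AddCommGroup V₁] [Module K V₁]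
  [AddCommGroup V₂] [Module K V₂] [FiniteDimensional K V]

/-- **Rank–nullity on a subspace**: `dim f(W) + dim (W ∩ ker f) = dim W`. [folklore] -/
theorem finrank_map_add_finrank_inf_ker (f : V →ₗ[K] V₁) (W : Submodule K V) :
    Module.finrank K ↥(W.map f) + Module.finrank K ↥(W ⊓ LinearMap.ker f) = Module.finrank K ↥W := by
  have h := LinearMap.finrank_range_add_finrank_ker (f.domRestrict W)
  rw [LinearMap.range_domRestrict, LinearMap.ker_domRestrict] at h
  have e : Submodule.comap W.subtype (LinearMap.ker f) = Submodule.comap W.subtype (W ⊓ LinearMap.ker f) := by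
    rw [Submodule.comap_inf, Submodule.comap_subtype_self, top_inf_eq]
  rw [e, (Submodule.comapSubtypeEquivOfLe (inf_le_left : W ⊓ LinearMap.ker f ≤ W)).finrank_eq] at h
  exact h

/-- **The product formula**: `dim (p, q)(W) = dim p(W) + dim q(W ∩ ker p)` (project `(p, q)(W) ↠ p(W)`; the kernel is
`q(W ∩ ker p)`). [folklore] -/
theorem finrank_map_prod_eq (p : V →ₗ[K] V₁) (q : V →ₗ[K] V₂) (W : Submodule K V) :
    Module.finrank K ↥(W.map (p.prod q)) =
      Module.finrank K ↥(W.map p) + Module.finrank K ↥((W ⊓ LinearMap.ker p).map q) := by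
  have h1 := finrank_map_add_finrank_inf_ker (p.prod q) W
  have h2 := finrank_map_add_finrank_inf_ker p W
  have h3 := finrank_map_add_finrank_inf_ker q (W ⊓ LinearMap.ker p)
  rw [LinearMap.ker_prod, ← inf_assoc] at h1
  omega

end LinAlg

variable {G : Type*} [Group G] [Fintype G] [DecidableEq G] (c : G)

/-! ## §2 The generic floor -/

/-- **Any linear map killing `rad2` has `dim L(hodge2) ≤ φ₂(G, c)`** (it factors through the coinvariant fibre). [folklore] -/
theorem finrank_map_hodge2_le_fibreTwo (hc2 : c * c = 1) {V' : Type*} [AddCommGroup V'] [Module (ZMod 2) V']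
    (L : (CMF G c →₀ ZMod 2) →ₗ[ZMod 2] V') (hL : rad2 c hc2 ≤ LinearMap.ker L) :
    Module.finrank (ZMod 2) ↥((hodge2 c hc2).map L) ≤ fibreTwo c hc2 := by
  have hfac : (hodge2 c hc2).map L = (fibre c hc2).map ((rad2 c hc2).liftQ L hL) := by
    rw [fibre, ← Submodule.map_comp, Submodule.liftQ_mkQ]
  rw [hfac, fibreTwo]
  exact Submodule.finrank_map_le _ _

/-- **`dim par2(hodge2) + 1 + δ = β`** (gen 28's exact rank of the block parities, `finrank_span_par_gfaceSet_add`). [folklore] -/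
theorem finrank_map_par2_hodge2_add (hc2 : c * c = 1) (T₀ : CMF G c) :
    Module.finrank (ZMod 2) ↥((hodge2 c hc2).map (par2 c)) + 1 + wdelta c T₀ = Fintype.card (Block c) := by
  rw [map_par2_hodge2, ← span_par_gfaceSet_eq_map]
  exact finrank_span_par_gfaceSet_add c hc2 T₀

/-- **The generic floor with the parities split off**: for ANY `L'` killing `rad2`,
`β + dim L'(hodge2 ∩ ker par2) ≤ φ₂ + 1 + δ`. [folklore] -/
theorem card_block_add_finrank_le_fibreTwo_add (hc2 : c * c = 1) (T₀ : CMF G c) {V' : Type*} [AddCommGroup V']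
    [Module (ZMod 2) V'] (L' : (CMF G c →₀ ZMod 2) →ₗ[ZMod 2] V') (hL' : rad2 c hc2 ≤ LinearMap.ker L') :
    Fintype.card (Block c) + Module.finrank (ZMod 2) ↥((hodge2 c hc2 ⊓ LinearMap.ker (par2 c)).map L') ≤
      fibreTwo c hc2 + 1 + wdelta c T₀ := by
  have h1 := finrank_map_hodge2_le_fibreTwo c hc2 ((par2 c).prod L')
    (by rw [LinearMap.ker_prod]; exact le_inf (rad2_le_ker_par2 c hc2) hL')
  rw [finrank_map_prod_eq] at h1
  have h2 := finrank_map_par2_hodge2_add c hc2 T₀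
  omega

/-! ## §3 The admissible half-block sets and the invariant `t(G, c)` -/

/-- **All admissible half-block sets** of `(G, c)`: the `A` which, for SOME index-two subgroup `H ∋ c`, are `H`-stable,
disjoint from `A·Q⁻¹` for `Q ∉ H`, and whose saturation is a parity relation on the faces mod `2`. [folklore] -/
def admHalves (hc2 : c * c = 1) : Finset (Finset (CMF G c)) := by
  classical
  exact (univ : Finset (Finset (CMF G c))).filter fun A =>
    ∃ H : Subgroup G, H.index = 2 ∧ c ∈ H ∧ (∀ Q ∈ H, ∀ Ψ ∈ A, rt c Q Ψ ∈ A) ∧ (∀ Q ∉ H, ∀ Ψ ∈ A, rt c Q Ψ ∉ A) ∧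
      face2 c hc2 ≤ LinearMap.ker (hsum c (sat c A))

/-- Membership in `admHalves`. [folklore] -/
theorem mem_admHalves (hc2 : c * c = 1) (A : Finset (CMF G c)) :
    A ∈ admHalves c hc2 ↔ ∃ H : Subgroup G, H.index = 2 ∧ c ∈ H ∧ (∀ Q ∈ H, ∀ Ψ ∈ A, rt c Q Ψ ∈ A) ∧
      (∀ Q ∉ H, ∀ Ψ ∈ A, rt c Q Ψ ∉ A) ∧ face2 c hc2 ≤ LinearMap.ker (hsum c (sat c A)) := by
  classical
  unfold admHalves
  rw [Finset.mem_filter]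
  simp only [Finset.mem_univ, true_and]

/-- Admissibility from its constituents. [folklore] -/
theorem mem_admHalves_of (hc2 : c * c = 1) {H : Subgroup G} (hH : H.index = 2) (hcH : c ∈ H) {A : Finset (CMF G c)}
    (hst : ∀ Q ∈ H, ∀ Ψ ∈ A, rt c Q Ψ ∈ A) (hdj : ∀ Q ∉ H, ∀ Ψ ∈ A, rt c Q Ψ ∉ A)
    (hrel : face2 c hc2 ≤ LinearMap.ker (hsum c (sat c A))) : A ∈ admHalves c hc2 :=
  (mem_admHalves c hc2 A).mpr ⟨H, hH, hcH, hst, hdj, hrel⟩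

/-- Every admissible half-parity kills the radical (part I MAIN). [folklore] -/
theorem rad2_le_ker_hsum_of_mem_admHalves (hc2 : c * c = 1) {A : Finset (CMF G c)} (hA : A ∈ admHalves c hc2) :
    rad2 c hc2 ≤ LinearMap.ker (hsum c A) := by
  obtain ⟨H, hH, hcH, hst, hdj, hrel⟩ := (mem_admHalves c hc2 A).mp hA
  exact rad2_le_ker_hsum c hH hcH hst hdj hrel

/-- **The joint evaluation** of all admissible half-parities: `x ↦ (hsum A x)_{A ∈ admHalves}`. [folklore] -/
def hpi (hc2 : c * c = 1) : (CMF G c →₀ ZMod 2) →ₗ[ZMod 2] (↥(admHalves c hc2) → ZMod 2) :=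
  LinearMap.pi fun A => hsum c A.1

/-- `hpi x A = hsum A x`. [folklore] -/
@[simp] theorem hpi_apply (hc2 : c * c = 1) (x : CMF G c →₀ ZMod 2) (A : ↥(admHalves c hc2)) :
    hpi c hc2 x A = hsum c A.1 x := rfl

/-- **`rad2 ≤ ker hpi`**: the joint evaluation is defined on the coinvariant fibre. [folklore] -/
theorem rad2_le_ker_hpi (hc2 : c * c = 1) : rad2 c hc2 ≤ LinearMap.ker (hpi c hc2) := by
  intro x hx
  rw [LinearMap.mem_ker]
  funext A
  exact LinearMap.mem_ker.mp (rad2_le_ker_hsum_of_mem_admHalves c hc2 A.2 hx)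

/-- **`t(G, c)`** — the number of independent half-parity classes beyond the block parities on the Hodge lattice mod `2`:
`dim_𝔽₂ hpi(hodge2 ∩ ker par2)` (André-3's «NEW half-parities», choice-free). [folklore] -/
def halfRank (hc2 : c * c = 1) : ℕ :=
  Module.finrank (ZMod 2) ↥((hodge2 c hc2 ⊓ LinearMap.ker (par2 c)).map (hpi c hc2))

/-! ## §4 THE FLOOR -/

/-- **THE HALF-PARITY FLOOR: `β(G, c) + t(G, c) ≤ φ₂(G, c) + 1 + δ(G, c)`**, i.e. `φ₂ ≥ β − 1 − δ + t`, for every finite group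
`G` and involution `c` — no census.  (André-3's law, 58/58 types of order `≤ 24`: equality.) [folklore] -/
theorem card_block_add_halfRank_le_fibreTwo_add (hc2 : c * c = 1) (T₀ : CMF G c) :
    Fintype.card (Block c) + halfRank c hc2 ≤ fibreTwo c hc2 + 1 + wdelta c T₀ :=
  card_block_add_finrank_le_fibreTwo_add c hc2 T₀ (hpi c hc2) (rad2_le_ker_hpi c hc2)

/-- `δ`-free form: `β + t ≤ φ₂ + 2`. [folklore] -/
theorem card_block_add_halfRank_le_fibreTwo_add_two (hc2 : c * c = 1) (hc1 : c ≠ 1) :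
    Fintype.card (Block c) + halfRank c hc2 ≤ fibreTwo c hc2 + 2 := by
  obtain ⟨T, hT⟩ := exists_isCMF c hc2 hc1
  have h := card_block_add_halfRank_le_fibreTwo_add c hc2 ⟨T, hT⟩
  have h1 := wdelta_le_one c ⟨T, hT⟩
  omega

/-- **THE FLOOR FOR HODGE FAMILIES: `|S| ≥ β − 1 − δ + t`.**  For central `c`: every finite family `S` of integer Hodge vectors
(`S ⊆ hodgeSpan`) with `faces ⊆ P₀ + ℤ[G]·S`, `P₀ ⊆ ℤ⟨pairs⟩`, has `β + t ≤ |S| + 1 + δ` (gen 29 `fibreTwo_le_card` + §4). [folklore] -/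
theorem card_block_add_halfRank_le_card_add (hc2 : c * c = 1) (hcen : ∀ x : G, x * c = c * x) (T₀ : CMF G c)
    (S : Finset (CMF G c →₀ ℤ)) (P₀ : Submodule ℤ (CMF G c →₀ ℤ)) (hP₀ : P₀ ≤ Submodule.span ℤ (pairSet c))
    (hS : (S : Set (CMF G c →₀ ℤ)) ⊆ hodgeSpan c hc2)
    (hX : gfaceSet G c hc2 ⊆ ↑(P₀ ⊔ Submodule.span ℤ (translates c S))) :
    Fintype.card (Block c) + halfRank c hc2 ≤ S.card + 1 + wdelta c T₀ := by
  have h1 := card_block_add_halfRank_le_fibreTwo_add c hc2 T₀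
  have h2 := fibreTwo_le_card c hc2 hcen S P₀ hP₀ hS hX
  omega

/-- **Face form** (`μ_F ≥ β − 1 − δ + t`): a finite set `S` of FACES with `faces ⊆ ℤ⟨pairs⟩ + ℤ[G]·S` has
`β + t ≤ |S| + 1 + δ`. [folklore] -/
theorem card_block_add_halfRank_le_card_add_of_faces (hc2 : c * c = 1) (hcen : ∀ x : G, x * c = c * x) (T₀ : CMF G c)
    (S : Finset (CMF G c →₀ ℤ)) (hS : (S : Set (CMF G c →₀ ℤ)) ⊆ gfaceSet G c hc2)
    (hX : gfaceSet G c hc2 ⊆ ↑(Submodule.span ℤ (pairSet c) ⊔ Submodule.span ℤ (translates c S))) :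
    Fintype.card (Block c) + halfRank c hc2 ≤ S.card + 1 + wdelta c T₀ := by
  have h1 := card_block_add_halfRank_le_fibreTwo_add c hc2 T₀
  have h2 := fibreTwo_le_card_of_faces c hc2 hcen S hS hX
  omega

/-! ## §5 Witness criteria for `t ≥ k` -/

/-- An explicit admissible family sees at most `t`: `dim (hsum Aᵢ)ᵢ (hodge2 ∩ ker par2) ≤ t(G, c)`. [folklore] -/
theorem finrank_map_pi_le_halfRank (hc2 : c * c = 1) {ι : Type*} [Fintype ι] (A : ι → Finset (CMF G c))
    (hA : ∀ i, A i ∈ admHalves c hc2) :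
    Module.finrank (ZMod 2) ↥((hodge2 c hc2 ⊓ LinearMap.ker (par2 c)).map (LinearMap.pi fun i => hsum c (A i))) ≤
      halfRank c hc2 := by
  let proj : (↥(admHalves c hc2) → ZMod 2) →ₗ[ZMod 2] (ι → ZMod 2) := LinearMap.pi fun i => LinearMap.proj ⟨A i, hA i⟩
  have hfac : (LinearMap.pi fun i => hsum c (A i)) = proj.comp (hpi c hc2) := by
    ext x i; rfl
  rw [hfac, Submodule.map_comp, halfRank]
  exact Submodule.finrank_map_le _ _

/-- **Dual-family criterion: `k ≤ t`.**  Admissible `A₁ … A_k` and vectors `x₁ … x_k ∈ hodge2` with `par2 xⱼ = 0` and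
`hsum Aᵢ xⱼ = δᵢⱼ` certify `k` independent new half-parity classes. [folklore] -/
theorem le_halfRank_of_dual_family (hc2 : c * c = 1) {ι : Type*} [Fintype ι] [DecidableEq ι] (A : ι → Finset (CMF G c))
    (hA : ∀ i, A i ∈ admHalves c hc2) (x : ι → (CMF G c →₀ ZMod 2)) (hx : ∀ j, x j ∈ hodge2 c hc2)
    (hpx : ∀ j, par2 c (x j) = 0) (hdual : ∀ i j, hsum c (A i) (x j) = if i = j then 1 else 0) :
    Fintype.card ι ≤ halfRank c hc2 := by
  let L : (CMF G c →₀ ZMod 2) →ₗ[ZMod 2] (ι → ZMod 2) := LinearMap.pi fun i => hsum c (A i)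
  let W := (hodge2 c hc2 ⊓ LinearMap.ker (par2 c)).map L
  have hmem : ∀ j, L (x j) ∈ W := fun j =>
    Submodule.mem_map_of_mem (Submodule.mem_inf.mpr ⟨hx j, LinearMap.mem_ker.mpr (hpx j)⟩)
  -- the images `L xⱼ` are the standard basis vectors, hence linearly independent in `W`
  have hL : ∀ j, L (x j) = Pi.single j 1 := fun j => by
    funext i
    rw [LinearMap.pi_apply, hdual, Pi.single_apply]
  have hli : LinearIndependent (ZMod 2) fun j => (⟨L (x j), hmem j⟩ : ↥W) := by
    rw [Fintype.linearIndependent_iff]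
    intro g hg j
    have h := congrArg (fun w : ↥W => (w : ι → ZMod 2) j) hg
    simp only [Submodule.coe_sum, Submodule.coe_smul, Finset.sum_apply, Pi.smul_apply, hL, Pi.single_apply,
      smul_eq_mul, mul_ite, mul_one, mul_zero, Finset.sum_ite_eq, Finset.mem_univ, if_true,
      Submodule.coe_zero, Pi.zero_apply] at h
    exact h
  calc Fintype.card ι = Module.finrank (ZMod 2) ↥(Submodule.span (ZMod 2) (Set.range fun j => (⟨L (x j), hmem j⟩ : ↥W))) :=
        (finrank_span_eq_card hli).symm
    _ ≤ Module.finrank (ZMod 2) ↥W := Submodule.finrank_le _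
    _ ≤ halfRank c hc2 := finrank_map_pi_le_halfRank c hc2 A hA

/-- **One witness gives `t ≥ 1`**: an admissible `A` and a Hodge vector `x` mod `2` with vanishing block parities and
`hsum A x ≠ 0` («`ψ_A` is NEW») force `β ≤ φ₂ + δ`. [folklore] -/
theorem one_le_halfRank_of_witness (hc2 : c * c = 1) {A : Finset (CMF G c)} (hA : A ∈ admHalves c hc2)
    {x : CMF G c →₀ ZMod 2} (hx : x ∈ hodge2 c hc2) (hpx : par2 c x = 0) (hAx : hsum c A x ≠ 0) : 1 ≤ halfRank c hc2 := by
  have h1 : hsum c A x = 1 := by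
    have h01 : ∀ u : ZMod 2, u ≠ 0 → u = 1 := by decide
    exact h01 _ hAx
  have h := le_halfRank_of_dual_family c hc2 (ι := Unit) (fun _ => A) (fun _ => hA) (fun _ => x) (fun _ => hx)
    (fun _ => hpx) (fun _ _ => by rw [if_pos (Subsingleton.elim _ _)]; exact h1)
  simpa using h

/-- … so **`β ≤ φ₂ + δ`** (one more than the parity floor) as soon as one new half-parity exists. [folklore] -/
theorem card_block_le_fibreTwo_add_of_witness (hc2 : c * c = 1) (T₀ : CMF G c) {A : Finset (CMF G c)}
    (hA : A ∈ admHalves c hc2) {x : CMF G c →₀ ZMod 2} (hx : x ∈ hodge2 c hc2) (hpx : par2 c x = 0)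
    (hAx : hsum c A x ≠ 0) : Fintype.card (Block c) ≤ fibreTwo c hc2 + wdelta c T₀ := by
  have h1 := one_le_halfRank_of_witness c hc2 hA hx hpx hAx
  have h2 := card_block_add_halfRank_le_fibreTwo_add c hc2 T₀
  omega

/-! ## §6 Vanishing of `t` when `φ₂` is the parity rank -/

/-- **`t = 0` whenever `φ₂ = dim span par(faces)`** (gen 29: cyclic `G`, `|G|/2` odd, split-cyclic `G`): then every admissible
half-parity is a block-parity combination on the Hodge lattice mod `2`. [folklore] -/
theorem halfRank_eq_zero_of_fibreTwo_eq (hc2 : c * c = 1)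
    (h : fibreTwo c hc2 = Module.finrank (ZMod 2) ↥(Submodule.span (ZMod 2) (par c '' gfaceSet G c hc2))) :
    halfRank c hc2 = 0 := by
  have h1 := finrank_map_hodge2_le_fibreTwo c hc2 ((par2 c).prod (hpi c hc2))
    (by rw [LinearMap.ker_prod]; exact le_inf (rad2_le_ker_par2 c hc2) (rad2_le_ker_hpi c hc2))
  rw [finrank_map_prod_eq, map_par2_hodge2, ← span_par_gfaceSet_eq_map, ← h] at h1
  unfold halfRank
  omega

end

end Summit.HodgeConjecture.CorCM.Census.HalfParity
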